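import Mathlib
import Summits.NavierStokesRegularity.NavierStokesRegularity.Theorems.FilamentSkeletonRssAreaLawSlavingPackage
import Summits.NavierStokesRegularity.NavierStokesRegularity.Theorems.FilamentSkeletonRssAreaLawSlavingDatumWindow

/-!
# Area-law slaving, part 9 — the ZEROTH ITERATE carries a complete area block, Γ-uniformly
# (`FilamentSkeletonRss`, child crux `TangentSkeletonNearStraight`, stmt-NavierStokesRegularity-28295, line
# `child_tangent_analytic_strip`; consistency / non-vacuity of the slaving package of part 5 at order zero)

The Newton scheme of the line starts from the straight skew datum rescaled to circulation `Γ`: curves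
`X⁰_j(τ) = √Γ·p_j + τ·t_j` and slips `w⁰_j(τ) = √Γ·W_j(τ/√Γ)`, `W_j` the datum's closed-form scaled slip (`StraightDatum`).  This file
checks that the zeroth iterate satisfies EVERY hypothesis of the slaving package `slavedArea_block` (part 5) with Γ-FREE constants, hence
carries core areas `Aa⁰` obeying the area law, the Γ-flat cone bound with a `KA` chosen before `Γ`, the floor `Λ⁻¹ ≤ Aa⁰` and
`Aa⁰_j(c_j) = 4/(W_j′(s₀_j) − 3/2)`:
* `datum_slip_eq`, `datum_slip_contDiff` — `W_j` is an explicit smooth function (part 8's rational representation);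
* `rescaled_slip_*` — the rescaled slip: zero at `c_j = √Γ s₀_j`, `(w⁰_j)′(τ) = W_j′(τ/√Γ)`, floor `mw`, slope bound `Λ`, window
  `σ₀√Γ` with `σ₀ = δπθρ³/(10N)` (part 8), far barrier with defect `c₀√Γ`, `c₀ = Rw/2 + θ⁻¹Rw + Nθ⁻¹/(2πρ)` (part 7), escape with `cg = 1`;
* `straightDatum_slavedArea_block` — HEADLINE: `∃ KA > 0` (Γ-free) such that for every `Γ > 0` the rescaled datum carries `Aa⁰` with
  the three area clauses of `FlatJ1G ∧ NearStraightJ1G` (area law for `w⁰`, cone `Rw²Γ·Aa⁰_j τ ≤ KA(Rw²Γ + ‖X⁰_j τ‖²)`, floor `Λ⁻¹ ≤ Aa⁰`).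
So the area block of the G-variant child is not only slaved (part 5) but INHABITED at order zero with the right Γ-scaling — the
base point of any perturbative construction of `TangentSkeletonNearStraight`.

HONEST FRAMING: bookkeeping about the straight datum of a HYPOTHETICAL filament skeleton on the NEGATIVE side of a MODEL route (A1G aside);
the zeroth iterate is NOT a skeleton (it is not tangent); nothing here bears on Navier–Stokes regularity or blow-up; no registered stub is closed.
`--supports stmt-NavierStokesRegularity-28295`.
-/

set_option linter.dupNamespace false

noncomputable section

namespace Summit.NavierStokesRegularity.NavierStokesRegularity.Theorems.AreaLawSlaving

open Set Real Finset
open Literature.Analysis.FluidPDE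
open scoped InnerProductSpace

/-! ## §1 The datum's slip is an explicit smooth function -/

/-- `‖d⁰ + s e‖²` is a quadratic polynomial in `s`. [folklore] -/
theorem normSq_affine_eq (d₀ e : EuclideanSpace ℝ (Fin 3)) :
    (fun s : ℝ => ‖d₀ + s • e‖ ^ 2) = fun s => ‖d₀‖ ^ 2 + 2 * ⟪d₀, e⟫_ℝ * s + ‖e‖ ^ 2 * s ^ 2 := by
  funext s
  rw [norm_add_sq_real, real_inner_smul_right, norm_smul, Real.norm_eq_abs, mul_pow, sq_abs]
  ring

/-- A partner term `s ↦ n/‖d⁰ + s e‖²` is smooth when the foot never vanishes. [folklore] -/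
theorem contDiff_partner {d₀ e : EuclideanSpace ℝ (Fin 3)} (n : ℝ) (hd : ∀ s : ℝ, d₀ + s • e ≠ 0) {m : ℕ∞} :
    ContDiff ℝ m fun s : ℝ => n / ‖d₀ + s • e‖ ^ 2 := by
  refine contDiff_const.div ?_ fun s => pow_ne_zero 2 (norm_ne_zero_iff.2 (hd s))
  rw [normSq_affine_eq]
  fun_prop

/-- **Explicit form of the datum's slip**: `W_j(s) = s/2 + K_j + Σ_{k≠j} (γ_k/2π)·n_jk/‖d⁰_jk + s e_jk‖²`. [folklore] -/
theorem datum_slip_eq {N : ℕ} {α : ℝ} {p t : Fin N → EuclideanSpace ℝ (Fin 3)} {γ : Fin N → ℝ}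
    (ht : ∀ j, ‖t j‖ = 1) (W : Fin N → ℝ → ℝ)
    (hW : ∀ j s, W j s = ⟪(∑ k ∈ Finset.univ.erase j, (γ k / (2 * Real.pi)) •
      ((‖(p j + s • t j - p k) - ⟪p j + s • t j - p k, t k⟫_ℝ • t k‖ ^ 2)⁻¹ •
        cross (t k) ((p j + s • t j - p k) - ⟪p j + s • t j - p k, t k⟫_ℝ • t k))) +
      (1 / 2 : ℝ) • (p j + s • t j) - α • cross (EuclideanSpace.single 2 1) (p j + s • t j), t j⟫_ℝ)
    (j : Fin N) :
    W j = fun s => (s - 0) / 2 + ((∑ k ∈ Finset.univ.erase j, (γ k / (2 * Real.pi)) *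
      (⟪cross (t k) ((p j - p k) - ⟪p j - p k, t k⟫_ℝ • t k), t j⟫_ℝ /
        ‖((p j - p k) - ⟪p j - p k, t k⟫_ℝ • t k) + s • (t j - ⟪t j, t k⟫_ℝ • t k)‖ ^ 2)) +
      (1 / 2) * ⟪p j + (0:ℝ) • t j, t j⟫_ℝ - α * ⟪cross (EuclideanSpace.single 2 1) (p j + (0:ℝ) • t j), t j⟫_ℝ) := by
  funext s
  rw [hW j s, datum_slip_decomp _ _ _ _ _ 0 (ht j), sum_inner]
  have hS : ∑ k ∈ Finset.univ.erase j, ⟪(γ k / (2 * Real.pi)) •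
      ((‖(p j + s • t j - p k) - ⟪p j + s • t j - p k, t k⟫_ℝ • t k‖ ^ 2)⁻¹ •
        cross (t k) ((p j + s • t j - p k) - ⟪p j + s • t j - p k, t k⟫_ℝ • t k)), t j⟫_ℝ =
      ∑ k ∈ Finset.univ.erase j, (γ k / (2 * Real.pi)) *
        (⟪cross (t k) ((p j - p k) - ⟪p j - p k, t k⟫_ℝ • t k), t j⟫_ℝ /
          ‖((p j - p k) - ⟪p j - p k, t k⟫_ℝ • t k) + s • (t j - ⟪t j, t k⟫_ℝ • t k)‖ ^ 2) :=
    Finset.sum_congr rfl fun k _ => by rw [real_inner_smul_left, partner_inner_eq]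
  rw [hS]

/-- **The datum's slip is smooth** (`C^m` for every finite `m`), for `ρ`-separated unit-direction lines. [folklore] -/
theorem datum_slip_contDiff {N : ℕ} {ρ α : ℝ} {p t : Fin N → EuclideanSpace ℝ (Fin 3)} {γ : Fin N → ℝ}
    (hρ : 0 < ρ) (ht : ∀ j, ‖t j‖ = 1)
    (hsep : ∀ j k, j ≠ k → ∀ τ σ : ℝ, ρ ≤ ‖(p j + τ • t j) - (p k + σ • t k)‖)
    (W : Fin N → ℝ → ℝ)
    (hW : ∀ j s, W j s = ⟪(∑ k ∈ Finset.univ.erase j, (γ k / (2 * Real.pi)) •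
      ((‖(p j + s • t j - p k) - ⟪p j + s • t j - p k, t k⟫_ℝ • t k‖ ^ 2)⁻¹ •
        cross (t k) ((p j + s • t j - p k) - ⟪p j + s • t j - p k, t k⟫_ℝ • t k))) +
      (1 / 2 : ℝ) • (p j + s • t j) - α • cross (EuclideanSpace.single 2 1) (p j + s • t j), t j⟫_ℝ)
    (j : Fin N) {m : ℕ∞} : ContDiff ℝ m (W j) := by
  rw [datum_slip_eq ht W hW j]
  have hfoot : ∀ k ∈ Finset.univ.erase j, ∀ x : ℝ,
      ((p j - p k) - ⟪p j - p k, t k⟫_ℝ • t k) + x • (t j - ⟪t j, t k⟫_ℝ • t k) ≠ 0 := by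
    intro k hk x h0
    have hkj : j ≠ k := fun h => (Finset.ne_of_mem_erase hk) h.symm
    have h := hsep j k hkj x (⟪p j + x • t j - p k, t k⟫_ℝ)
    have e1 : (p j + x • t j) - (p k + ⟪p j + x • t j - p k, t k⟫_ℝ • t k) =
        (p j + x • t j - p k) - ⟪p j + x • t j - p k, t k⟫_ℝ • t k := by abel
    rw [e1, foot_affine, h0, norm_zero] at h
    linarith
  have hsum : ContDiff ℝ m fun s => ∑ k ∈ Finset.univ.erase j, (γ k / (2 * Real.pi)) *
      (⟪cross (t k) ((p j - p k) - ⟪p j - p k, t k⟫_ℝ • t k), t j⟫_ℝ /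
        ‖((p j - p k) - ⟪p j - p k, t k⟫_ℝ • t k) + s • (t j - ⟪t j, t k⟫_ℝ • t k)‖ ^ 2) :=
    ContDiff.sum fun k hk => contDiff_const.mul (contDiff_partner _ (hfoot k hk))
  exact ((contDiff_id.sub contDiff_const).div_const _).add ((hsum.add contDiff_const).sub contDiff_const)

/-! ## §2 The rescaled slip `w⁰(τ) = √Γ·W(τ/√Γ)` -/

/-- Chain rule for the rescaled slip: `(√Γ·W(·/√Γ))′(τ) = W′(τ/√Γ)`. [folklore] -/
theorem rescaled_slip_hasDerivAt {W : ℝ → ℝ} (hW : Differentiable ℝ W) {Γ : ℝ} (hΓ : 0 < Γ) (τ : ℝ) :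
    HasDerivAt (fun τ => √Γ * W (τ / √Γ)) (deriv W (τ / √Γ)) τ := by
  have hsq : 0 < √Γ := Real.sqrt_pos.2 hΓ
  have h1 : HasDerivAt (fun τ : ℝ => τ / √Γ) (1 / √Γ) τ := by
    have := (hasDerivAt_id' τ).div_const (√Γ)
    simpa using this
  have h2 : HasDerivAt (fun τ => W (τ / √Γ)) (deriv W (τ / √Γ) * (1 / √Γ)) τ :=
    (hW _).hasDerivAt.comp τ h1
  have h3 := h2.const_mul (√Γ)
  refine h3.congr_deriv ?_
  field_simp

/-- Derivative of the rescaled slip. [folklore] -/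
theorem rescaled_slip_deriv {W : ℝ → ℝ} (hW : Differentiable ℝ W) {Γ : ℝ} (hΓ : 0 < Γ) (τ : ℝ) :
    deriv (fun τ => √Γ * W (τ / √Γ)) τ = deriv W (τ / √Γ) :=
  (rescaled_slip_hasDerivAt hW hΓ τ).deriv

/-- The rescaled slip is `C^m` if `W` is. [folklore] -/
theorem rescaled_slip_contDiff {W : ℝ → ℝ} {m : ℕ∞} (hW : ContDiff ℝ m W) (Γ : ℝ) :
    ContDiff ℝ m fun τ => √Γ * W (τ / √Γ) :=
  contDiff_const.mul (hW.comp (contDiff_id.div_const _))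

/-- `|τ/√Γ − s₀| = |τ − √Γ s₀|/√Γ`. [folklore] -/
theorem abs_rescale {Γ : ℝ} (hΓ : 0 < Γ) (τ s₀ : ℝ) : |τ / √Γ - s₀| = |τ - √Γ * s₀| / √Γ := by
  have hsq : 0 < √Γ := Real.sqrt_pos.2 hΓ
  rw [show τ / √Γ - s₀ = (τ - √Γ * s₀) / √Γ by field_simp, abs_div, abs_of_pos hsq]

/-! ## §3 The zeroth iterate carries a slaved area block -/

/-- **ZEROTH ITERATE: complete area block, Γ-uniformly.**  Straight skew datum (`N ≥ 1` lines `p_j + s t_j`, unit directions,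
`ρ`-separated, `|α|, |γ_k| ≤ θ⁻¹`, waist points `‖p_j + s₀_j t_j‖ ≤ Rw`, closed-form slips `W_j` with `W_j(s₀_j) = 0`, floor
`mw|s − s₀_j| ≤ |W_j|`, `W_j′(s₀_j) ≥ 3/2 + δ`, `|W_j′| ≤ Λ`).  Then `∃ KA > 0`, depending on the datum constants only, such that for
every `Γ > 0` the rescaled iterate `w⁰_j(τ) = √Γ W_j(τ/√Γ)`, `X⁰_j(τ) = √Γ p_j + τ t_j` carries core areas `Aa⁰` with
(i) the area-law conjunct of `FlatJ1G` for `w⁰`, (ii) the Γ-flat cone `Rw²Γ·Aa⁰_j τ ≤ KA(Rw²Γ + ‖X⁰_j τ‖²)`, (iii) the floor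
`Λ⁻¹ ≤ Aa⁰`, (iv) `Aa⁰_j(√Γ s₀_j) = 4/(W_j′(s₀_j) − 3/2)`. [folklore] -/
theorem straightDatum_slavedArea_block {N : ℕ} {δ ρ Λ Rw θ mw α : ℝ} {p t : Fin N → EuclideanSpace ℝ (Fin 3)}
    {γ : Fin N → ℝ} {s₀ : Fin N → ℝ} (hN : 0 < N) (hδ : 0 < δ) (hρ : 0 < ρ) (hθ : 0 < θ) (hmw : 0 < mw)
    (ht : ∀ j, ‖t j‖ = 1) (hsep : ∀ j k, j ≠ k → ∀ τ σ : ℝ, ρ ≤ ‖(p j + τ • t j) - (p k + σ • t k)‖)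
    (hα : |α| ≤ θ⁻¹) (hγ : ∀ j, |γ j| ≤ θ⁻¹) (hwaist : ∀ j, ‖p j + s₀ j • t j‖ ≤ Rw)
    (W : Fin N → ℝ → ℝ)
    (hW : ∀ j s, W j s = ⟪(∑ k ∈ Finset.univ.erase j, (γ k / (2 * Real.pi)) •
      ((‖(p j + s • t j - p k) - ⟪p j + s • t j - p k, t k⟫_ℝ • t k‖ ^ 2)⁻¹ •
        cross (t k) ((p j + s • t j - p k) - ⟪p j + s • t j - p k, t k⟫_ℝ • t k))) +
      (1 / 2 : ℝ) • (p j + s • t j) - α • cross (EuclideanSpace.single 2 1) (p j + s • t j), t j⟫_ℝ)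
    (hzero : ∀ j, W j (s₀ j) = 0) (hfloorW : ∀ j s, mw * |s - s₀ j| ≤ |W j s|)
    (hsupW : ∀ j, 3 / 2 + δ ≤ deriv (W j) (s₀ j)) (hΛW : ∀ j s, |deriv (W j) s| ≤ Λ) :
    ∃ KA : ℝ, 0 < KA ∧ ∀ Γ : ℝ, 0 < Γ →
      ∃ Aa : Fin N → ℝ → ℝ,
        (∀ j, Differentiable ℝ (Aa j) ∧ (∀ τ, 0 < Aa j τ) ∧
          ∀ τ, (√Γ * W j (τ / √Γ)) * deriv (Aa j) τ =
            (3 / 2 - deriv (fun τ => √Γ * W j (τ / √Γ)) τ) * Aa j τ + 4) ∧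
        (∀ j τ, Rw ^ 2 * Γ * Aa j τ ≤ KA * (Rw ^ 2 * Γ + ‖√Γ • p j + τ • t j‖ ^ 2)) ∧
        (∀ j τ, Λ⁻¹ ≤ Aa j τ) ∧
        (∀ j, Aa j (√Γ * s₀ j) = 4 / (deriv (W j) (s₀ j) - 3 / 2)) := by
  -- datum constants
  have hNr : (0:ℝ) < N := by exact_mod_cast hN
  have j₀ : Fin N := ⟨0, hN⟩
  have hRw : 0 ≤ Rw := (norm_nonneg _).trans (hwaist j₀)
  have hΛ0 : 0 ≤ Λ := (abs_nonneg _).trans (hΛW j₀ 0)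
  set σ₀ : ℝ := δ * (Real.pi * θ * ρ ^ 3) / (10 * N) with hσ₀
  set c₀ : ℝ := Rw / 2 + θ⁻¹ * Rw + N * θ⁻¹ / (2 * Real.pi * ρ) with hc₀
  set σ₁ : ℝ := max σ₀ (2 * c₀ + 2) with hσ₁
  have hσ₀pos : 0 < σ₀ := by rw [hσ₀]; positivity
  have hc₀nn : 0 ≤ c₀ := by rw [hc₀]; positivity
  have hσ₁ge : σ₀ ≤ σ₁ := le_max_left _ _
  have hu : 0 < σ₁ / 2 - c₀ := by have := le_max_right σ₀ (2 * c₀ + 2); rw [← hσ₁] at this; linarith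
  have hδ2 : 0 < δ / 2 := by linarith
  obtain ⟨KA, hKA, hblock⟩ := slavedArea_block (N := N) (Rw := Rw) hδ2 hσ₀pos hσ₁ge hmw hc₀nn hu hΛ0 one_pos
  refine ⟨KA, hKA, fun Γ hΓ => ?_⟩
  have hsq : 0 < √Γ := Real.sqrt_pos.2 hΓ
  -- smoothness and differentiability of the datum slips
  have hWC : ∀ j, ContDiff ℝ 2 (W j) := fun j => datum_slip_contDiff (m := 2) hρ ht hsep W hW j
  have hWd : ∀ j, Differentiable ℝ (W j) := fun j => (hWC j).differentiable two_ne_zero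
  -- the rescaled slip's hypotheses
  have hw : ∀ j, ContDiff ℝ 2 (fun τ => √Γ * W j (τ / √Γ)) := fun j => rescaled_slip_contDiff (hWC j) Γ
  have hc : ∀ j, (fun τ => √Γ * W j (τ / √Γ)) (√Γ * s₀ j) = 0 := by
    intro j; simp only; rw [mul_div_cancel_left₀ _ hsq.ne', hzero j, mul_zero]
  have hfloor : ∀ j τ, mw * |τ - √Γ * s₀ j| ≤ |(fun τ => √Γ * W j (τ / √Γ)) τ| := by
    intro j τ
    simp only
    have h := hfloorW j (τ / √Γ)
    rw [abs_rescale hΓ] at h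
    rw [abs_mul, abs_of_pos hsq]
    have h2 := mul_le_mul_of_nonneg_left h hsq.le
    calc mw * |τ - √Γ * s₀ j| = √Γ * (mw * (|τ - √Γ * s₀ j| / √Γ)) := by field_simp
      _ ≤ √Γ * |W j (τ / √Γ)| := h2
  have huniq : ∀ j τ, (fun τ => √Γ * W j (τ / √Γ)) τ = 0 → τ = √Γ * s₀ j := by
    intro j τ h0
    have h := hfloor j τ
    rw [h0, abs_zero] at h
    have : |τ - √Γ * s₀ j| ≤ 0 := by nlinarith [abs_nonneg (τ - √Γ * s₀ j)]
    exact sub_eq_zero.mp (abs_nonpos_iff.mp this)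
  have hΛ : ∀ j τ, |deriv (fun τ => √Γ * W j (τ / √Γ)) τ| ≤ Λ := by
    intro j τ; rw [rescaled_slip_deriv (hWd j) hΓ]; exact hΛW j _
  have hsup : ∀ j s, |s - √Γ * s₀ j| ≤ σ₀ * √Γ → 3 / 2 + δ / 2 ≤ deriv (fun τ => √Γ * W j (τ / √Γ)) s := by
    intro j s hs
    rw [rescaled_slip_deriv (hWd j) hΓ]
    refine datum_slip_window hρ hθ ht hsep hγ W hW j (hsupW j) ?_
    rw [abs_rescale hΓ, div_le_iff₀ hsq, ← hσ₀]
    exact hs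
  have hfar : ∀ j τ, σ₁ * √Γ ≤ |τ - √Γ * s₀ j| →
      |τ - √Γ * s₀ j| / 2 - c₀ * √Γ ≤ |(fun τ => √Γ * W j (τ / √Γ)) τ| := by
    intro j τ _
    simp only
    have h := datum_slip_far_barrier hρ hθ ht hsep hα hγ hwaist W hW j (τ / √Γ)
    rw [← hc₀, abs_rescale hΓ] at h
    rw [abs_mul, abs_of_pos hsq]
    have h2 := mul_le_mul_of_nonneg_left h hsq.le
    calc |τ - √Γ * s₀ j| / 2 - c₀ * √Γ = √Γ * (|τ - √Γ * s₀ j| / √Γ / 2 - c₀) := by field_simp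
      _ ≤ √Γ * |W j (τ / √Γ)| := h2
  have hesc : ∀ j τ, 1 * |τ - √Γ * s₀ j| ≤ Rw * √Γ + ‖√Γ • p j + τ • t j‖ := by
    intro j τ
    have hX : √Γ • p j + τ • t j = √Γ • (p j + s₀ j • t j) + (τ - √Γ * s₀ j) • t j := by
      rw [smul_add, smul_smul, sub_smul, mul_smul]; abel
    have h1 : ‖(τ - √Γ * s₀ j) • t j‖ = |τ - √Γ * s₀ j| := by rw [norm_smul, Real.norm_eq_abs, ht j, mul_one]
    have h2 : ‖√Γ • (p j + s₀ j • t j)‖ ≤ Rw * √Γ := by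
      rw [norm_smul, Real.norm_eq_abs, abs_of_pos hsq, mul_comm]
      exact mul_le_mul_of_nonneg_right (hwaist j) hsq.le
    have h3 : ‖(τ - √Γ * s₀ j) • t j‖ ≤ ‖√Γ • p j + τ • t j‖ + ‖√Γ • (p j + s₀ j • t j)‖ := by
      have := norm_sub_le (√Γ • p j + τ • t j) (√Γ • (p j + s₀ j • t j))
      have e : √Γ • p j + τ • t j - √Γ • (p j + s₀ j • t j) = (τ - √Γ * s₀ j) • t j := by
        rw [hX]; abel
      rw [e] at this
      exact this
    rw [one_mul]
    linarith
  obtain ⟨Aa, hAa, hcone, hfl, hAc⟩ := hblock Γ hΓ (fun j τ => √Γ * W j (τ / √Γ)) (fun j => √Γ * s₀ j)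
    (fun j τ => √Γ • p j + τ • t j) hw hc huniq hsup hΛ hfloor hfar hesc
  refine ⟨Aa, hAa, hcone, hfl, fun j => ?_⟩
  rw [hAc j, rescaled_slip_deriv (hWd j) hΓ, mul_div_cancel_left₀ _ hsq.ne']

end Summit.NavierStokesRegularity.NavierStokesRegularity.Theorems.AreaLawSlaving

end
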